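import Literature.AlgebraicGeometry.AbelianSchemes.AbelianSchemeQuotientPolarizationExistsAmple
import Literature.AlgebraicGeometry.AbelianSchemes.AbelianSchemeOverRingAction
import Literature.AlgebraicGeometry.Motives.AlgPointsMapSurjectiveAlgClosed
import Literature.Algebra.Module.DivisibleActionSurjective
import HarnessLib

/-!
# `ι(b)_s` is surjective, hence dominant and onto on geometric points, for every `b ≠ 0` of a ring-of-integers action
# ([MumfordAV1970] §6 App. 2 (p. 62), §19 Thm. 3 (p. 174); [MumfordFogartyKirwan1994] Ch. 6 §2 Def. 6.3)

Topic `Literature/AlgebraicGeometry/AbelianSchemes`; namespace `Literature.AlgebraicGeometry.AbelianSchemes.AbelianSchemeOver`.  THEOREMS ONLY (no definition, no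
named fact, no instance, no notation, no `sorry`).  Cell `hodgecm-mathlib` (D-0151), P6 «MOD» (crux hLiu418 = stmt-HodgeConjecture-24832, `--supports`,
count-neutral): line L3 (`stub_FROB`), ROOF road (ρ-𝔟), LA3-plan RULING #5 (C) → LA3-p03 (g2) «the engine's residual rows BY NAME: `hsurj` …, DOMINANCE of
`ι(b)_s` …» — the `IsDominant (ι(b)_s)` conjunct of the `hros` binder of ★ `weilPairingLevel_eq_one_of_restrictPt_of_comp_i_eq_one` (F4b) ∕ ★
`hiso_of_idealTorsion_of_rosati`, and the `hsurj` binder «`ι(r)_s` onto on `A_s(Ω)`» in its NATIVE currency `AlgPoints.map (fibreHom (act.i r) s).hom.hom.hom`.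
NO isogeny theory of `ι(b)`: if `π ≫ ψ = [d]` with `d ≠ 0` then `π_s ≫ ψ_s = [d]_{A_s}` (★ `toSchemeHom_fibreHom_comp_fibreHom_of_comp_eq_mulN`), `[d]_{A_s}` is an
isogeny hence surjective (★ `isIsogeny_zsmul_id_holds`, any characteristic), so `ψ_s` is surjective (Mathlib `Surjective.of_comp`), dominant, and onto on
`Ω`-points for `Ω` algebraically closed (★ `AlgPoints.map_surjective_of_surjective_of_isAlgClosed'`).  For `𝒪 = 𝓞 F` and `b ≠ 0` take `π := ι(n∕b)`,
`d := n := N((b))` (`b ∣ n`, ★ `DivisibleActionSurjective.exists_nat_ne_zero_dvd`; `ι(b′) ≫ ι(b) = ι(b b′) = ι(n) = [n]`, ★ `RingAction.i_mul`∕`i_nsmul`∕`i_one`).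
HC_CM is proved only modulo the printed citations until rung 0 closes; this file is generic and changes no count.

* §1 (any `S`, any field `Ω`) `surjective_toSchemeHom_fibreHom_of_comp_eq_mulN` (the `Surjective` form of ★
  `isDominant_toSchemeHom_fibreHom_of_comp_eq_mulN`), `map_fibreHom_surjective_of_comp_eq_mulN` (`Ω` algebraically closed).
* §2 (ring action, any commutative `𝒪`) `i_comp_i_eq_mulN_of_mul_eq_natCast` (`b·b′ = n ⇒ ι(b′) ≫ ι(b) = [n]`), `surjective_toSchemeHom_fibreHom_i_of_dvd_natCast`,
  `isDominant_toSchemeHom_fibreHom_i_of_dvd_natCast`, `map_fibreHom_i_surjective_of_dvd_natCast`.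
* §3 (`𝒪 = 𝓞 F`) **`isDominant_toSchemeHom_fibreHom_i_of_ne_zero`** (the `hros` dominance conjunct), **`surjective_toSchemeHom_fibreHom_i_of_ne_zero`**,
  **`map_fibreHom_i_surjective_of_ne_zero`** (`hsurj` in F4b's native currency: `∀ r ≠ 0, Surjective (AlgPoints.map (fibreHom (act.i r) s).hom.hom.hom)`).

## References
* [MumfordAV1970] D. Mumford, *Abelian Varieties* (1970), §6 Application 2 (p. 62), §19 Thm. 3 (p. 174).
* [MumfordFogartyKirwan1994] D. Mumford, J. Fogarty, F. Kirwan, *Geometric Invariant Theory*, 3rd ed. (1994), Ch. 6 §2 Definition 6.3 (p. 120).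
* [MilneANT2008] J. S. Milne, *Algebraic Number Theory* (v3.00), Rem. 3.12 (p. 43) (`N(𝔞) ∈ 𝔞`).
-/

set_option autoImplicit false

universe u

open CategoryTheory CategoryTheory.Limits AlgebraicGeometry

noncomputable section

namespace Literature.AlgebraicGeometry.AbelianSchemes

namespace AbelianSchemeOver

open Literature.AlgebraicGeometry.Motives
open scoped MonObj

/-! ### §1 A factor of `[d]` is surjective on every fibre -/

section Fibre

variable {S : Scheme.{u}} {B A' : AbelianSchemeOver S} (π : B.X ⟶ A'.X) [IsMonHom π] (ψ : A'.X ⟶ B.X) [IsMonHom ψ]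
  {Ω : Type u} [Field Ω] (s : Spec (.of Ω) ⟶ S) {d : ℕ}

/-- **`ψ_s` is SURJECTIVE when `π ≫ ψ = [d]_B` with `d ≠ 0`**: `π_s ≫ ψ_s = [d]_{B_s}` (★ `toSchemeHom_fibreHom_comp_fibreHom_of_comp_eq_mulN`) and `[d]` of
the fibre abelian variety is an isogeny, in particular surjective (★ `isIsogeny_zsmul_id_holds`); surjectivity passes to the second factor.
[cite: MumfordAV1970, §6 Application 2 (p. 62)] -/
theorem surjective_toSchemeHom_fibreHom_of_comp_eq_mulN (hd : d ≠ 0) (h : π ≫ ψ = B.mulN d) :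
    Surjective (AbelianVariety.Hom.toSchemeHom (fibreHom ψ s)) := by
  have hiso := AbelianVariety.isIsogeny_zsmul_id_holds (B.fibre s).toAbelianVariety (d : ℤ) (by exact_mod_cast hd)
  haveI : Surjective (AbelianVariety.Hom.toSchemeHom (fibreHom π s ≫ fibreHom ψ s)) := by
    rw [toSchemeHom_fibreHom_comp_fibreHom_of_comp_eq_mulN π ψ s h]
    exact hiso.1
  haveI : Surjective (AbelianVariety.Hom.toSchemeHom (fibreHom π s) ≫ AbelianVariety.Hom.toSchemeHom (fibreHom ψ s)) :=
    inferInstanceAs (Surjective (AbelianVariety.Hom.toSchemeHom (fibreHom π s ≫ fibreHom ψ s)))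
  exact Surjective.of_comp (f := AbelianVariety.Hom.toSchemeHom (fibreHom π s)) _

/-- **`ψ_s` is onto on `Ω`-points** for `Ω` algebraically closed, when `π ≫ ψ = [d]_B`, `d ≠ 0` (★ `AlgPoints.map_surjective_of_surjective_of_isAlgClosed'`).
[cite: MumfordAV1970, §6 Application 2 (p. 62)] -/
theorem map_fibreHom_surjective_of_comp_eq_mulN [IsAlgClosed Ω] (hd : d ≠ 0) (h : π ≫ ψ = B.mulN d) :
    Function.Surjective (AlgPoints.map (L := Ω) (fibreHom ψ s).hom.hom.hom) := by
  haveI : Surjective (AbelianVariety.Hom.toSchemeHom (fibreHom ψ s)) := surjective_toSchemeHom_fibreHom_of_comp_eq_mulN π ψ s hd h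
  haveI : Surjective (fibreHom ψ s).hom.hom.hom.left := inferInstanceAs (Surjective (AbelianVariety.Hom.toSchemeHom (fibreHom ψ s)))
  exact AlgPoints.map_surjective_of_surjective_of_isAlgClosed' (L := Ω) (fibreHom ψ s).hom.hom.hom

end Fibre

/-! ### §2 Ring actions: `b·b′ = n ⇒ ι(b′) ≫ ι(b) = [n]` -/

section Action

variable {S : Scheme.{u}} {A : AbelianSchemeOver S} {O : Type*} [CommRing O] (act : A.RingAction O)
  {Ω : Type u} [Field Ω] (s : Spec (.of Ω) ⟶ S)

/-- `b · b′ = n` (a natural number) ⇒ `ι(b′) ≫ ι(b) = [n]` (★ `RingAction.i_mul`, `i_nsmul`, `i_one`). [cite: MumfordFogartyKirwan1994, Ch. 6 §2 Definition 6.3 (p. 120)] -/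
theorem i_comp_i_eq_mulN_of_mul_eq_natCast {b b' : O} {n : ℕ} (h : b * b' = n) : act.i b' ≫ act.i b = A.mulN n := by
  rw [← act.i_mul, h, mulN_def, ← Nat.smul_one_eq_cast, act.i_nsmul, act.i_one]

/-- **`ι(b)_s` is SURJECTIVE** when `b ∣ n` for a natural number `n ≠ 0`. [cite: MumfordAV1970, §6 Application 2 (p. 62)] -/
theorem surjective_toSchemeHom_fibreHom_i_of_dvd_natCast {b : O} {n : ℕ} (hn : n ≠ 0) (hdvd : b ∣ (n : O)) :
    haveI := act.isMonHom b
    Surjective (AbelianVariety.Hom.toSchemeHom (fibreHom (act.i b) s)) := by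
  obtain ⟨b', hb'⟩ := hdvd
  haveI := act.isMonHom b
  haveI := act.isMonHom b'
  exact surjective_toSchemeHom_fibreHom_of_comp_eq_mulN (act.i b') (act.i b) s hn (i_comp_i_eq_mulN_of_mul_eq_natCast act hb'.symm)

/-- **`ι(b)_s` is DOMINANT** when `b ∣ n`, `n ≠ 0`. [cite: MumfordAV1970, §6 Application 2 (p. 62)] -/
theorem isDominant_toSchemeHom_fibreHom_i_of_dvd_natCast {b : O} {n : ℕ} (hn : n ≠ 0) (hdvd : b ∣ (n : O)) :
    haveI := act.isMonHom b
    IsDominant (AbelianVariety.Hom.toSchemeHom (fibreHom (act.i b) s)) := by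
  obtain ⟨b', hb'⟩ := hdvd
  haveI := act.isMonHom b
  haveI := act.isMonHom b'
  exact isDominant_toSchemeHom_fibreHom_of_comp_eq_mulN (act.i b) (act.i b') s hn (i_comp_i_eq_mulN_of_mul_eq_natCast act hb'.symm)

/-- **`ι(b)_s` is onto on `Ω`-points** (`Ω` algebraically closed) when `b ∣ n`, `n ≠ 0`. [cite: MumfordAV1970, §6 Application 2 (p. 62)] -/
theorem map_fibreHom_i_surjective_of_dvd_natCast [IsAlgClosed Ω] {b : O} {n : ℕ} (hn : n ≠ 0) (hdvd : b ∣ (n : O)) :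
    haveI := act.isMonHom b
    Function.Surjective (AlgPoints.map (L := Ω) (fibreHom (act.i b) s).hom.hom.hom) := by
  obtain ⟨b', hb'⟩ := hdvd
  haveI := act.isMonHom b
  haveI := act.isMonHom b'
  exact map_fibreHom_surjective_of_comp_eq_mulN (act.i b') (act.i b) s hn (i_comp_i_eq_mulN_of_mul_eq_natCast act hb'.symm)

end Action

/-! ### §3 The ring of integers of a number field: every `b ≠ 0` -/

section RingOfIntegers

open NumberField

variable {S : Scheme.{u}} {A : AbelianSchemeOver S} {F : Type*} [Field F] [NumberField F] (act : A.RingAction (𝓞 F))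
  {Ω : Type u} [Field Ω] (s : Spec (.of Ω) ⟶ S)

/-- **THE `hros` DOMINANCE CONJUNCT: `ι(b)_s` is dominant for every `b ≠ 0` in `𝓞 F`**, on every fibre of an abelian scheme with an `𝓞 F`-action, over ANY
field `Ω`. [cite: MumfordAV1970, §6 Application 2 (p. 62) and §19 Thm. 3 (p. 174)] -/
theorem isDominant_toSchemeHom_fibreHom_i_of_ne_zero {b : 𝓞 F} (hb : b ≠ 0) :
    haveI := act.isMonHom b
    IsDominant (AbelianVariety.Hom.toSchemeHom (fibreHom (act.i b) s)) := by
  obtain ⟨n, hn, hdvd⟩ := Literature.Algebra.Module.DivisibleActionSurjective.exists_nat_ne_zero_dvd b hb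
  exact isDominant_toSchemeHom_fibreHom_i_of_dvd_natCast act s hn hdvd

/-- **`ι(b)_s` is surjective for every `b ≠ 0` in `𝓞 F`.** [cite: MumfordAV1970, §6 Application 2 (p. 62) and §19 Thm. 3 (p. 174)] -/
theorem surjective_toSchemeHom_fibreHom_i_of_ne_zero {b : 𝓞 F} (hb : b ≠ 0) :
    haveI := act.isMonHom b
    Surjective (AbelianVariety.Hom.toSchemeHom (fibreHom (act.i b) s)) := by
  obtain ⟨n, hn, hdvd⟩ := Literature.Algebra.Module.DivisibleActionSurjective.exists_nat_ne_zero_dvd b hb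
  exact surjective_toSchemeHom_fibreHom_i_of_dvd_natCast act s hn hdvd

/-- **THE `hsurj` BINDER IN NATIVE CURRENCY: `ι(r)_s` is onto on `A_s(Ω)` for every `r ≠ 0` in `𝓞 F`** (`Ω` algebraically closed, ANY characteristic).
[cite: MumfordAV1970, §6 Application 2 (p. 62) and §19 Thm. 3 (p. 174)] -/
theorem map_fibreHom_i_surjective_of_ne_zero [IsAlgClosed Ω] {r : 𝓞 F} (hr : r ≠ 0) :
    haveI := act.isMonHom r
    Function.Surjective (AlgPoints.map (L := Ω) (fibreHom (act.i r) s).hom.hom.hom) := by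
  obtain ⟨n, hn, hdvd⟩ := Literature.Algebra.Module.DivisibleActionSurjective.exists_nat_ne_zero_dvd r hr
  exact map_fibreHom_i_surjective_of_dvd_natCast act s hn hdvd

/-- `hsurj` for a fibre action given as a variable `φ` with `φ r x = ι(r)_s x` (the `hφ` shape of ★ F4b).
[cite: MumfordAV1970, §6 Application 2 (p. 62)] -/
theorem fibreAction_surjective_of_ne_zero [IsAlgClosed Ω]
    (φ : 𝓞 F → (A.fibre s).toAbelianVariety.Points Ω → (A.fibre s).toAbelianVariety.Points Ω)
    (hφ : ∀ r x, φ r x = haveI := act.isMonHom r; AlgPoints.map (fibreHom (act.i r) s).hom.hom.hom x) :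
    ∀ r : 𝓞 F, r ≠ 0 → Function.Surjective (φ r) := by
  intro r hr y
  obtain ⟨x, hx⟩ := map_fibreHom_i_surjective_of_ne_zero act s hr y
  exact ⟨x, by rw [hφ]; exact hx⟩

end RingOfIntegers

end AbelianSchemeOver

end Literature.AlgebraicGeometry.AbelianSchemes

end
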